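import Summits.QuantumFields.BalabanUV.Beta.GAN24.ContactBorderCommutator
import Summits.QuantumFields.BalabanUV.Beta.GAN24.SymContactBorderKernelCells
import Summits.QuantumFields.BalabanUV.Beta.GAN24.SymLinKernelExpansion
import Summits.QuantumFields.BalabanUV.Beta.GAN24.SymVHClassCurrentSym
import Summits.QuantumFields.BalabanUV.Beta.CompositeCorrectorLinear
import Summits.QuantumFields.BalabanUV.Beta.SymCorrectorForms

/-!
# `GAN24.SymContactBorderCommutator` — the PACKED sym first-order partner `linSym04At` of the border cells through the `q¹_sym`-pairing (normalisation `((d+1)!·L^{d+1})⁻¹`), the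
# one-gauge border cells FACTORISED — the sym twin of leaf-02 g48's (E) `GAN24.ContactBorderCommutator` over `SymContactBorderKernelCells` (+ `symLinAvgAt_smul`, the sym twin of
# an1's naturality `linAvgAt_mapForm` at `φ = c • id`)

NOT IN PRINT — OUR BOOKKEEPING (OWNER `b2b-balaban-gan24-p1` gen 55, 2026-08-28; row G-an2-4 ∕ (CONV-C), TRANSFER-III, the (III′) S-slot (b), born-V contact letters `hCv ∕ hPcV`
of road-P2 M.104 — TABLE HALF at an1's (0.4)-SYMMETRISED border table `symVhSAt ρ` and (0.4) packed first-order kernel `linSym04At ρ L` (the OWNER's memo `HCV-DESIGN-g55.md` §1∕§2):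
a mkroot-style token re-run of the (E) file named below with `vhSAt ρ ↦ symVhSAt ρ`, `linSymAt ↦ linSym04At`, `linKerAt ∕ linCountAt ∕ linAvgAt ↦ symLinKerAt ∕ symLinCountAt ∕ symLinAvgAt`
(an1's `SymAveragingHessianCounts`, d1's `SymmetrisedAxialPotential`), the `q¹`-pairing normalisation `(L^{d+1})⁻¹ ↦ ((d+1)!·L^{d+1})⁻¹` (leaf-02 g55 `SymLinKernelExpansion.tsum_sum_symLinKerAt_mul`)
and the count constant `L^{d+1}·ℓ ↦ (d+1)!·(L^{d+1}·ℓ)` (an1's `abs_symLinCountAt_le`, leaf-01 g90's `SymContactFaceJumpCommutator.sum_abs_symLinCountAt_le`) carried VERBATIM through every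
statement; every TABLE-FREE lemma of the (E) files is consumed BY NAME (not copied), and leaf-01 g90's `SymContactFaceJump ∕ SymContactFaceJumpCommutator` supply the shared sym
count ∕ commutator letters.  [folklore] bookkeeping; 0 `def`, 0 cited fact, 0 `def … : Prop`, 0 sorry; NO estimate of Bałaban's beyond an1's DEFINED kernels.
HONEST FRAMING (cell contract, verbatim): «discharging `BetaPertH` makes Bałaban's UV stability UNCONDITIONAL — a real constructive-QFT result; it is NOT the continuum limit
and NOT the Clay problem.»  HONEST DEPENDENCY (verbatim): «continuum YM on T⁴ ⇐ BetaPertH ∧ nine spine estimates (0/9 proved); BetaPertH ⇐ (D1) ∧ (D4) ∧ CAP+tail; G-an2-4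
gates asym, D1 and NE2/3/4.»  Discharges NO letter of M.104 ∕ of the OWNER's END `CombChargeRowsOfBornContactLetters` (hCv ∕ hPcV stay HYPOTHESES); NEVER «G-an2-4 closed» as
(CONV-C); NOT D1, NOT BetaPertH, NOT continuum, NOT Clay.  2026-08-28; no existing file touched.

## What (same statements as the (E) file under the substitutions above; `Sym…` namespace)
`symLinAvgAt_smul`, `tsum_sum_mul_weight_mul_linSym04At`, `tsum_sum_mul_tipWeight_mul_linSym04At`, `tsum_sum_mul_rootWeight_mul_linSym04At`, `tsum_sum_leg_mul_tsum_sum_mul_rootWeight`, `tsum_sum_leg_mul_tsum_sum_mul_tipWeight`, `contact_border_fm_eq_factorised`, `contact_border_mf_eq_factorised`.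
-/

open Finset
open scoped BigOperators
open Literature.MathematicalPhysics.QuantumFieldTheory.Balaban1983to89
open Literature.MathematicalPhysics.QuantumFieldTheory.Balaban1983to89.Beta
open AffineAveraging AveragingContours AveragingHessianKernels AveragingContoursRooted AveragingHessianKernelsRooted
open B12Sec2to5 (l1 l1_nonneg)
open ExpKernelCalculus (l1_sub_triangle l1_sub_symm)
open StepJetData (l1_unitVec)
open AveragingWardStencils (b6UnitVec_eq)
open InterLevelTransport (SLam)
open ExpKernelCalculus (MKer)
open OneStepResolventKernel (Fib)
open Summit.QuantumFields.BalabanUV.Beta.SymAveragingHessianCounts (symVhSAt symVhSAt_symm symVhKerAt_eq_zero_left symVhKerAt_eq_zero_right symLinKerAt_eq_zero abs_symLinKerAt_le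
  locStencil_symVhSAt)
open Summit.QuantumFields.BalabanUV.Beta.SymAveragingWardRootedStencils (lin04KerAt_eq_symLinKerAt)
open Summit.QuantumFields.BalabanUV.Beta.DshAn1 (linSym04At linSym04At_inl_inr linSym04At_inr_inl linSym04At_inl_inl linSym04At_inr_inr linSym04At_symm)
open Summit.QuantumFields.BalabanUV.Beta.LinearGaugeVH (nearBox mem_nearBox summable_of_finsupp)
open Summit.QuantumFields.BalabanUV.Beta.GAN24.SymContactBorderPartner (off_eq_zero_and_near_of_linSym04At_ne_zero abs_linSym04At_inl_inr_le)
open Summit.QuantumFields.BalabanUV.Beta.GAN24.ContactBorderPartner (exists_finset_near_card l1_farEnd_sub_le_of_mem)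
open Summit.QuantumFields.BalabanUV.Beta.GAN24.ContactOneGaugeCellLambda (l1_root_sub_le_of_mem)
open Summit.QuantumFields.BalabanUV.Beta.GAN24.TaylorLamBracket (summable_uncurry_of_fibre_bound)
open Summit.QuantumFields.BalabanUV.Beta.GAN24.Push3 (push₃ push₃_smul)
open Summit.QuantumFields.BalabanUV.Beta.GAN24.SrecLinearPartEq (reslot)
open Summit.QuantumFields.BalabanUV.Beta.GAN24.SymContactBorderKernelCells (contact_border_fm_eq_cells contact_border_mf_eq_cells)
open Summit.QuantumFields.BalabanUV.Beta.GAN24.ContactLambdaCommutator (abs_sub_le_mul_l1_of_dz prox_of_near)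
open Summit.QuantumFields.BalabanUV.Beta.GAN24.SymLinKernelExpansion (tsum_sum_symLinKerAt_mul)

noncomputable section

open Summit.QuantumFields.BalabanUV.Beta.GAN24.ContactBorderCommutator (reslot_smul push₃_reslot_smul tsum_sum_mul_tsum_sum_mul_comm)

open Summit.QuantumFields.BalabanUV.Beta.SymmetrisedAxialPotential (symLinAvgAt symAxial)
open Summit.QuantumFields.BalabanUV.Beta.SymCorrectorForms (symAxial_smul)
open Summit.QuantumFields.BalabanUV.Beta.CompositeCorrectorLinear (segUp_sum_smul)
open Summit.QuantumFields.BalabanUV.Beta.GAN24.SymVHClassCurrentSym (symLinAvgAt_sub')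

namespace Summit.QuantumFields.BalabanUV.Beta.GAN24.SymContactBorderCommutator

variable {d : ℕ}

/-! ## §0 Homogeneity of the symmetrised rooted averaging (bookkeeping) -/

/-- [folklore] **THE SYMMETRISED ROOTED AVERAGING IS ℝ-HOMOGENEOUS**: `symLinAvgAt ρ (c • A) L μ y = c · symLinAvgAt ρ A L μ y` (d1-leaf-03's `symAxial_smul`, an2's
`segUp_sum_smul`) — the sym twin of an1's naturality `linAvgAt_mapForm` at `φ = c • id`. -/
theorem symLinAvgAt_smul (ρ : Site (d + 1)) (c : ℝ) (A : Form1 (d + 1) ℝ) (L : ℕ) (μ : Fin (d + 1)) (y : Site (d + 1)) :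
    symLinAvgAt ρ (c • A) L μ y = c * symLinAvgAt ρ A L μ y := by
  simp only [symLinAvgAt, symAxial_smul, segUp_sum_smul, Finset.mul_sum]
  refine Finset.sum_congr rfl fun b _ => ?_
  ring

/-! ## §0 Docking letters: re-slotting and the three-leg push are linear in the table (the V lineage carries the SCALED table `cVH • symVhSAt ρ`) -/

section Docking



end Docking

/-! ## §1 The packed partner through the `q¹`-pairing; the two weights of the border cells -/

section Pairing

variable {L : ℕ} {r : Fin (d + 1) → ℕ}

/-- [folklore] **THE PACKED PARTNER THROUGH THE `q¹`-PAIRING** (box root; every fine leg `T`, every weight `w`):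
`Σ'_u Σ_κ T κ u·(w κ u·q(u,z)(inl κ)(inr μ)) = [off L z = 0]·(L^{d+1})⁻¹·symLinAvgAt ρ (w•T) L μ (blk L z)`. -/
theorem tsum_sum_mul_weight_mul_linSym04At (hr : r ∈ box (d + 1) L) (T w : Form1 (d + 1) ℝ) (μ : Fin (d + 1)) (z : Fin (d + 1) → ℤ) :
    ∑' u, ∑ κ, T κ u * (w κ u * linSym04At (toSite r) L u z (Sum.inl κ) (Sum.inr μ))
      = if off L z = 0 then ((((d + 1).factorial : ℕ) : ℝ) * (L : ℝ) ^ (d + 1))⁻¹ * symLinAvgAt (toSite r) (fun κ u => w κ u * T κ u) L μ (blk L z) else 0 := by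
  by_cases hz : off L z = 0
  · rw [if_pos hz, ← tsum_sum_symLinKerAt_mul hr (fun κ u => w κ u * T κ u) μ (blk L z)]
    refine tsum_congr fun u => Finset.sum_congr rfl fun κ _ => ?_
    rw [linSym04At_inl_inr, if_pos hz, lin04KerAt_eq_symLinKerAt]
    ring
  · rw [if_neg hz]
    refine (tsum_congr fun u => ?_).trans tsum_zero
    exact Finset.sum_eq_zero fun κ _ => by rw [linSym04At_inl_inr, if_neg hz, mul_zero, mul_zero]

/-- [folklore] **TIP WEIGHT** (the fluctuation-slot border cell: `ψ` at the tip of the fine bond minus a constant `c` — in the cells `c = ψ(z + ρ + L·e_μ)`, the far end of the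
coarse bond): `Σ'_u Σ_κ T κ u·((ψ(u + e_κ) − c)·q(u,z)(inl κ)(inr μ)) = [off L z = 0]·(L^{d+1})⁻¹·(symLinAvgAt ρ (ψ⁺•T) L μ (blk L z) − c·symLinAvgAt ρ T L μ (blk L z))`. -/
theorem tsum_sum_mul_tipWeight_mul_linSym04At (hr : r ∈ box (d + 1) L) (T : Form1 (d + 1) ℝ) (ψ : (Fin (d + 1) → ℤ) → ℝ) (c : ℝ)
    (μ : Fin (d + 1)) (z : Fin (d + 1) → ℤ) :
    ∑' u, ∑ κ, T κ u * ((ψ (u + unitVec κ) - c) * linSym04At (toSite r) L u z (Sum.inl κ) (Sum.inr μ))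
      = if off L z = 0 then ((((d + 1).factorial : ℕ) : ℝ) * (L : ℝ) ^ (d + 1))⁻¹ *
          (symLinAvgAt (toSite r) (fun κ u => ψ (u + unitVec κ) * T κ u) L μ (blk L z) - c * symLinAvgAt (toSite r) T L μ (blk L z)) else 0 := by
  rw [tsum_sum_mul_weight_mul_linSym04At hr T (fun κ u => ψ (u + unitVec κ) - c) μ z]
  by_cases hz : off L z = 0
  · rw [if_pos hz, if_pos hz]
    have e : (fun κ u => (ψ (u + unitVec κ) - c) * T κ u) = (fun κ u => ψ (u + unitVec κ) * T κ u) - fun κ u => c * T κ u := by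
      funext κ u; simp only [Pi.sub_apply]; ring
    have e2 : (fun κ u => c * T κ u) = c • T := by
      funext κ u; rfl
    rw [e, symLinAvgAt_sub', e2, symLinAvgAt_smul]
  · rw [if_neg hz, if_neg hz]

/-- [folklore] **ROOT WEIGHT** (the index-slot border cell: a constant `c` — in the cells `c = ψ(z + ρ)`, the root — minus `ψ` at the base of the fine bond):
`Σ'_x Σ_a T a x·((c − ψ x)·q(x,z)(inl a)(inr μ)) = [off L z = 0]·(L^{d+1})⁻¹·(c·symLinAvgAt ρ T L μ (blk L z) − symLinAvgAt ρ (ψ•T) L μ (blk L z))`. -/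
theorem tsum_sum_mul_rootWeight_mul_linSym04At (hr : r ∈ box (d + 1) L) (T : Form1 (d + 1) ℝ) (ψ : (Fin (d + 1) → ℤ) → ℝ) (c : ℝ)
    (μ : Fin (d + 1)) (z : Fin (d + 1) → ℤ) :
    ∑' x, ∑ a, T a x * ((c - ψ x) * linSym04At (toSite r) L x z (Sum.inl a) (Sum.inr μ))
      = if off L z = 0 then ((((d + 1).factorial : ℕ) : ℝ) * (L : ℝ) ^ (d + 1))⁻¹ *
          (c * symLinAvgAt (toSite r) T L μ (blk L z) - symLinAvgAt (toSite r) (fun a x => ψ x * T a x) L μ (blk L z)) else 0 := by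
  rw [tsum_sum_mul_weight_mul_linSym04At hr T (fun _ x => c - ψ x) μ z]
  by_cases hz : off L z = 0
  · rw [if_pos hz, if_pos hz]
    have e : (fun a x => (c - ψ x) * T a x) = (fun a x => c * T a x) - fun a x => ψ x * T a x := by
      funext a x; simp only [Pi.sub_apply]; ring
    have e2 : (fun a x => c * T a x) = c • T := by
      funext a x; rfl
    rw [e, symLinAvgAt_sub', e2, symLinAvgAt_smul]
  · rw [if_neg hz, if_neg hz]

end Pairing

/-! ## §2 The dominated exchange for the border cell whose fine leg sits outside the packed sum -/

section Exchange

variable {L : ℕ} {r : Fin (d + 1) → ℕ}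


/-- [folklore] **THE TABLE-SLOT BORDER CELL WITH THE FINE LEG OUTER, EXCHANGED AND FACTORISED** (fine leg `R` with summable slices, multiplier leg `M` bounded, gauge function
of bounded gradient; box root): `Σ'_z Σ_b R b z·Σ'_x Σ_a M a x·((ψ(x + ρ) − ψ z)·q(z,x)(inl b)(inr a))
= (L^{d+1})⁻¹·Σ'_x Σ_a M a x·[off L x = 0]·(ψ(x + ρ)·symLinAvgAt ρ R L a (blk L x) − symLinAvgAt ρ (ψ•R) L a (blk L x))`. -/
theorem tsum_sum_leg_mul_tsum_sum_mul_rootWeight (hL : 1 ≤ L) (hr : r ∈ box (d + 1) L)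
    {M : Form1 (d + 1) ℝ} {CM : ℝ} (hM : ∀ a x, |M a x| ≤ CM)
    {R : Form1 (d + 1) ℝ} (hRs : ∀ b, Summable fun z => R b z)
    {ψ : (Fin (d + 1) → ℤ) → ℝ} {G : ℝ} (hψ : ∀ κ x, |dz ψ κ x| ≤ G) :
    ∑' z, ∑ b, R b z * ∑' x, ∑ a, M a x * ((ψ (x + toSite r) - ψ z) * linSym04At (toSite r) L z x (Sum.inl b) (Sum.inr a))
      = ∑' x, ∑ a, M a x * (if off L x = 0 then ((((d + 1).factorial : ℕ) : ℝ) * (L : ℝ) ^ (d + 1))⁻¹ *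
          (ψ (x + toSite r) * symLinAvgAt (toSite r) R L a (blk L x) - symLinAvgAt (toSite r) (fun b z => ψ z * R b z) L a (blk L x)) else 0) := by
  have hG : 0 ≤ G := (abs_nonneg _).trans (hψ 0 0)
  have hK0 : ∀ a x b z, ¬ (off L x = 0 ∧ Near L (blk L x) z) →
      (ψ (x + toSite r) - ψ z) * linSym04At (toSite r) L z x (Sum.inl b) (Sum.inr a) = 0 := fun a x b z h => by
    by_cases hq : linSym04At (toSite r) L z x (Sum.inl b) (Sum.inr a) = 0
    · rw [hq, mul_zero]
    · exact absurd (off_eq_zero_and_near_of_linSym04At_ne_zero hr hq) h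
  have hK : ∀ a x b z, off L x = 0 ∧ Near L (blk L x) z →
      |(ψ (x + toSite r) - ψ z) * linSym04At (toSite r) L z x (Sum.inl b) (Sum.inr a)| ≤ G * (((d : ℝ) + 1) * (2 * (L : ℝ))) * (ell (d + 1) L : ℝ) := by
    intro a x b z h
    rw [abs_mul]
    refine mul_le_mul ?_ (abs_linSym04At_inl_inr_le hL hr b z x a) (abs_nonneg _) (by positivity)
    have hx : x + toSite r = (L : ℤ) • blk L x + toSite r := by rw [← eq_smul_blk_of_off_eq_zero hL h.1]
    refine (abs_sub_le_mul_l1_of_dz hψ z (x + toSite r)).trans (mul_le_mul_of_nonneg_left ?_ hG)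
    rw [hx]
    exact l1_root_sub_le_of_mem hr (prox_of_near h.2)
  rw [tsum_sum_mul_tsum_sum_mul_comm hL hK0 hK hM hRs]
  refine tsum_congr fun x => Finset.sum_congr rfl fun a _ => ?_
  rw [tsum_sum_mul_rootWeight_mul_linSym04At hr R ψ (ψ (x + toSite r)) a x]

/-- [folklore] **THE FLUCTUATION-SLOT BORDER CELL WITH THE FINE LEG OUTER, EXCHANGED AND FACTORISED** (the shape of `SymContactOneGaugeCellBorder.cellVflu_eq`'s right-hand side; fine
leg `T` with summable slices, multiplier leg `M` bounded, gauge function of bounded gradient; box root):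
`Σ'_u Σ_κ T κ u·Σ'_z Σ_μ M μ z·((ψ(u + e_κ) − ψ(z + ρ + L·e_μ))·q(u,z)(inl κ)(inr μ))
= Σ'_z Σ_μ M μ z·[off L z = 0]·(L^{d+1})⁻¹·(symLinAvgAt ρ (ψ⁺•T) L μ (blk L z) − ψ(z + ρ + L·e_μ)·symLinAvgAt ρ T L μ (blk L z))`. -/
theorem tsum_sum_leg_mul_tsum_sum_mul_tipWeight (hL : 1 ≤ L) (hr : r ∈ box (d + 1) L)
    {M : Form1 (d + 1) ℝ} {CM : ℝ} (hM : ∀ μ z, |M μ z| ≤ CM)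
    {T : Form1 (d + 1) ℝ} (hTs : ∀ κ, Summable fun u => T κ u)
    {ψ : (Fin (d + 1) → ℤ) → ℝ} {G : ℝ} (hψ : ∀ κ x, |dz ψ κ x| ≤ G) :
    ∑' u, ∑ κ, T κ u * ∑' z, ∑ μ, M μ z * ((ψ (u + unitVec κ) - ψ (z + toSite r + (L : ℤ) • unitVec μ)) * linSym04At (toSite r) L u z (Sum.inl κ) (Sum.inr μ))
      = ∑' z, ∑ μ, M μ z * (if off L z = 0 then ((((d + 1).factorial : ℕ) : ℝ) * (L : ℝ) ^ (d + 1))⁻¹ *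
          (symLinAvgAt (toSite r) (fun κ u => ψ (u + unitVec κ) * T κ u) L μ (blk L z)
            - ψ (z + toSite r + (L : ℤ) • unitVec μ) * symLinAvgAt (toSite r) T L μ (blk L z)) else 0) := by
  have hG : 0 ≤ G := (abs_nonneg _).trans (hψ 0 0)
  have hK0 : ∀ μ z κ u, ¬ (off L z = 0 ∧ Near L (blk L z) u) →
      (ψ (u + unitVec κ) - ψ (z + toSite r + (L : ℤ) • unitVec μ)) * linSym04At (toSite r) L u z (Sum.inl κ) (Sum.inr μ) = 0 := fun μ z κ u h => by
    by_cases hq : linSym04At (toSite r) L u z (Sum.inl κ) (Sum.inr μ) = 0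
    · rw [hq, mul_zero]
    · exact absurd (off_eq_zero_and_near_of_linSym04At_ne_zero hr hq) h
  have hK : ∀ μ z κ u, off L z = 0 ∧ Near L (blk L z) u →
      |(ψ (u + unitVec κ) - ψ (z + toSite r + (L : ℤ) • unitVec μ)) * linSym04At (toSite r) L u z (Sum.inl κ) (Sum.inr μ)|
        ≤ G * (((d : ℝ) + 1) * (2 * (L : ℝ)) + 1) * (ell (d + 1) L : ℝ) := by
    intro μ z κ u h
    rw [abs_mul]
    refine mul_le_mul ?_ (abs_linSym04At_inl_inr_le hL hr κ u z μ) (abs_nonneg _) (by positivity)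
    have hz : z + toSite r + (L : ℤ) • unitVec μ = (L : ℤ) • blk L z + toSite r + (L : ℤ) • unitVec μ := by
      rw [← eq_smul_blk_of_off_eq_zero hL h.1]
    refine (abs_sub_le_mul_l1_of_dz hψ _ (u + unitVec κ)).trans (mul_le_mul_of_nonneg_left ?_ hG)
    calc l1 (u + unitVec κ - (z + toSite r + (L : ℤ) • unitVec μ))
        ≤ l1 (u + unitVec κ - u) + l1 (u - (z + toSite r + (L : ℤ) • unitVec μ)) := l1_sub_triangle _ _ _
      _ = 1 + l1 (u - (z + toSite r + (L : ℤ) • unitVec μ)) := by rw [add_sub_cancel_left, ← b6UnitVec_eq, l1_unitVec]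
      _ ≤ 1 + ((d : ℝ) + 1) * (2 * (L : ℝ)) := by
          rw [l1_sub_symm, hz]
          have := l1_farEnd_sub_le_of_mem hr (prox_of_near h.2) μ
          linarith
      _ = ((d : ℝ) + 1) * (2 * (L : ℝ)) + 1 := add_comm _ _
  rw [tsum_sum_mul_tsum_sum_mul_comm hL hK0 hK hM hTs]
  refine tsum_congr fun z => Finset.sum_congr rfl fun μ _ => ?_
  rw [tsum_sum_mul_tipWeight_mul_linSym04At hr T ψ (ψ (z + toSite r + (L : ℤ) • unitVec μ)) μ z]

end Exchange

/-! ## §3 The V-born kernel sockets re-read: every cell = (multiplier leg at the packed site) × (two-site commutator of the fine leg) -/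

section Sockets

variable {L : ℕ} {rr : Fin (d + 1) → ℕ}

/-- [folklore] **`contact_border_fm_eq_cells`, FACTORISED** (same hypotheses as `SymContactBorderKernelCells.contact_border_fm_eq_cells`): channel `reslot inl inr V`,
`push₃ lᴱ M wᴱ S − push₃ lᴮ M wᴮ S (x′,z′,inl α,inl β) = Σ'_z Σ_μ M βz′ μ z·[off z = 0]·(L^{d+1})⁻¹·(symLinAvgAt ρ (λ_L⁺•wᴱ_{κ′u′}) − λ_L(z+ρ+L·e_μ)·symLinAvgAt ρ wᴱ_{κ′u′}) (μ, blk z)`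
`+ Σ'_z Σ_μ M βz′ μ z·[off z = 0]·(L^{d+1})⁻¹·(λ_W(z+ρ)·symLinAvgAt ρ lᴮ_{αx′} − symLinAvgAt ρ (λ_W•lᴮ_{αx′})) (μ, blk z)`. -/
theorem contact_border_fm_eq_factorised {lE lB M wE wB : Fin (d + 1) → (Fin (d + 1) → ℤ) → Fin (d + 1) → (Fin (d + 1) → ℤ) → ℝ}
    {lamL lamW : Fin (d + 1) → (Fin (d + 1) → ℤ) → (Fin (d + 1) → ℤ) → ℝ} {ClE ClB CwE CwB : ℝ}
    (hL : 1 ≤ L) (hrr : rr ∈ box (d + 1) L)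
    (hlE : ∀ α x' κ x, |lE α x' κ x| ≤ ClE) (hlEs : ∀ α x' κ, Summable fun x => lE α x' κ x)
    (hlB : ∀ α x' κ x, |lB α x' κ x| ≤ ClB) (hlBs : ∀ α x' κ, Summable fun x => lB α x' κ x)
    (hMs : ∀ β z' κ, Summable fun z => M β z' κ z)
    (hwE : ∀ κ' u' κ u, |wE κ' u' κ u| ≤ CwE) (hwB : ∀ κ' u' κ u, |wB κ' u' κ u| ≤ CwB)
    (hLg : lE - lB = fun μ y κ u => dz (lamL μ y) κ u) (hWg : wE - wB = fun μ y κ u => dz (lamW μ y) κ u)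
    (κ' : Fin (d + 1)) (u' x' z' : Fin (d + 1) → ℤ) (α β : Fin (d + 1)) :
    push₃ lE M wE (reslot Sum.inl Sum.inr (symVhSAt (toSite rr) d L rfl)) κ' u' x' z' (Sum.inl α) (Sum.inl β)
        - push₃ lB M wB (reslot Sum.inl Sum.inr (symVhSAt (toSite rr) d L rfl)) κ' u' x' z' (Sum.inl α) (Sum.inl β)
      = (∑' z, ∑ μ, M β z' μ z * (if off L z = 0 then ((((d + 1).factorial : ℕ) : ℝ) * (L : ℝ) ^ (d + 1))⁻¹ *
            (symLinAvgAt (toSite rr) (fun κ u => lamL α x' (u + unitVec κ) * wE κ' u' κ u) L μ (blk L z)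
              - lamL α x' (z + toSite rr + (L : ℤ) • unitVec μ) * symLinAvgAt (toSite rr) (wE κ' u') L μ (blk L z)) else 0))
        + (∑' z, ∑ μ, M β z' μ z * (if off L z = 0 then ((((d + 1).factorial : ℕ) : ℝ) * (L : ℝ) ^ (d + 1))⁻¹ *
            (lamW κ' u' (z + toSite rr) * symLinAvgAt (toSite rr) (lB α x') L μ (blk L z)
              - symLinAvgAt (toSite rr) (fun a x => lamW κ' u' x * lB α x' a x) L μ (blk L z)) else 0)) := by
  rw [contact_border_fm_eq_cells hL hrr hlE hlEs hlB hlBs hMs hwE hwB hLg hWg]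
  simp only [tsum_sum_mul_tipWeight_mul_linSym04At hrr (wE κ' u') (lamL α x'),
    tsum_sum_mul_rootWeight_mul_linSym04At hrr (lB α x') (lamW κ' u')]

/-- [folklore] **`contact_border_mf_eq_cells`, FACTORISED** (same hypotheses as `SymContactBorderKernelCells.contact_border_mf_eq_cells`; the gradient letter of `λ_W` is the table-leg
bound through `wᴱ − wᴮ = dz λ_W`): channel `reslot inr inl V`, RIGHT cell pointwise, TABLE cell after the exchange of §2:
`push₃ M rᴱ wᴱ S − push₃ M rᴮ wᴮ S (x′,z′,inl α,inl β) = Σ'_x Σ_a M αx′ a x·[off x = 0]·(L^{d+1})⁻¹·(symLinAvgAt ρ (λ_R⁺•wᴱ_{κ′u′}) − λ_R(x+ρ+L·e_a)·symLinAvgAt ρ wᴱ_{κ′u′}) (a, blk x)`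
`+ Σ'_x Σ_a M αx′ a x·[off x = 0]·(L^{d+1})⁻¹·(λ_W(x+ρ)·symLinAvgAt ρ rᴮ_{βz′} − symLinAvgAt ρ (λ_W•rᴮ_{βz′})) (a, blk x)`. -/
theorem contact_border_mf_eq_factorised {M rE rB wE wB : Fin (d + 1) → (Fin (d + 1) → ℤ) → Fin (d + 1) → (Fin (d + 1) → ℤ) → ℝ}
    {lamR lamW : Fin (d + 1) → (Fin (d + 1) → ℤ) → (Fin (d + 1) → ℤ) → ℝ} {CM CrE CrB CwE CwB : ℝ}
    (hL : 1 ≤ L) (hrr : rr ∈ box (d + 1) L)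
    (hM : ∀ α x' κ x, |M α x' κ x| ≤ CM) (hMs : ∀ α x' κ, Summable fun x => M α x' κ x)
    (hrE : ∀ β z' κ z, |rE β z' κ z| ≤ CrE) (hrEs : ∀ β z' κ, Summable fun z => rE β z' κ z)
    (hrB : ∀ β z' κ z, |rB β z' κ z| ≤ CrB) (hrBs : ∀ β z' κ, Summable fun z => rB β z' κ z)
    (hwE : ∀ κ' u' κ u, |wE κ' u' κ u| ≤ CwE) (hwB : ∀ κ' u' κ u, |wB κ' u' κ u| ≤ CwB)
    (hRg : rE - rB = fun μ y κ u => dz (lamR μ y) κ u) (hWg : wE - wB = fun μ y κ u => dz (lamW μ y) κ u)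
    (κ' : Fin (d + 1)) (u' x' z' : Fin (d + 1) → ℤ) (α β : Fin (d + 1)) :
    push₃ M rE wE (reslot Sum.inr Sum.inl (symVhSAt (toSite rr) d L rfl)) κ' u' x' z' (Sum.inl α) (Sum.inl β)
        - push₃ M rB wB (reslot Sum.inr Sum.inl (symVhSAt (toSite rr) d L rfl)) κ' u' x' z' (Sum.inl α) (Sum.inl β)
      = (∑' x, ∑ a, M α x' a x * (if off L x = 0 then ((((d + 1).factorial : ℕ) : ℝ) * (L : ℝ) ^ (d + 1))⁻¹ *
            (symLinAvgAt (toSite rr) (fun κ u => lamR β z' (u + unitVec κ) * wE κ' u' κ u) L a (blk L x)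
              - lamR β z' (x + toSite rr + (L : ℤ) • unitVec a) * symLinAvgAt (toSite rr) (wE κ' u') L a (blk L x)) else 0))
        + (∑' x, ∑ a, M α x' a x * (if off L x = 0 then ((((d + 1).factorial : ℕ) : ℝ) * (L : ℝ) ^ (d + 1))⁻¹ *
            (lamW κ' u' (x + toSite rr) * symLinAvgAt (toSite rr) (rB β z') L a (blk L x)
              - symLinAvgAt (toSite rr) (fun b z => lamW κ' u' z * rB β z' b z) L a (blk L x)) else 0)) := by
  have hgW : ∀ κ u, |dz (lamW κ' u') κ u| ≤ CwE + CwB := fun κ u => by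
    have e : dz (lamW κ' u') κ u = (wE - wB) κ' u' κ u := by rw [hWg]
    rw [e, Pi.sub_apply, Pi.sub_apply, Pi.sub_apply, Pi.sub_apply]
    exact (abs_sub _ _).trans (add_le_add (hwE κ' u' κ u) (hwB κ' u' κ u))
  rw [contact_border_mf_eq_cells hL hrr hM hMs hrE hrEs hrB hrBs hwE hwB hRg hWg,
    tsum_sum_leg_mul_tsum_sum_mul_rootWeight hL hrr (M := M α x') (hM α x') (R := rB β z') (hrBs β z') hgW]
  simp only [tsum_sum_mul_tipWeight_mul_linSym04At hrr (wE κ' u') (lamR β z')]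

end Sockets

end Summit.QuantumFields.BalabanUV.Beta.GAN24.SymContactBorderCommutator

end
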